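import Summits.ResolutionOfSingularities.ResolutionOfSingularities.Theorems.FrobeniusLadderFInjectiveMacaulayficationOmegaLocalCureRow
import Summits.ResolutionOfSingularities.ResolutionOfSingularities.Theorems.FrobeniusLadderFInjectiveMacaulayficationHypersurfaceFullClAllPoints
import Mathlib.FieldTheory.IsAlgClosed.AlgebraicClosure
import HarnessLib

/-!
# TASK 4c (r2⁺) — THE Ω₁ LOCAL CURE ROW AT EVERY POINT (closed or not, any residue field): the complete chart-level statement
# (crux `FInjectiveMacaulayfication` stmt-ResolutionOfSingularities-15315, chain w45a; res-L1-w45a-plan-1 RULING R23.16 (r2) + its «every point» remainder; seat res-L1-w45a-stub-3 g13; engine =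
# ✓ `HypersurfaceFullClAllPoints` (Fedder at a prime via Jacobson + primary contraction, over ✓p703451ʼs geometric argument), applied to ✓p702704ʼs row over `K = AlgebraicClosure k`;
# supersedes the closed-point file `…OmegaLocalCureRowClosedPoints` in strength)

[OURS · L1 W4.5a] Support file (`--supports stmt-ResolutionOfSingularities-15315 --as helper`); theorems only; no definitions, no named facts. Nothing of the crux is proved; the census letter
«CURED» for Ω₁ (GLOBAL patch) is NOT claimed. AI-written (AI review is weaker than expert review).

THE ROW (chart level, local models): for every prime `p ≥ 5`, every field `k` of characteristic `p`, each certified cure fan (G9 / G10 / G10Q of ✓p694236, strengthened ✓ `cert'_*`), every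
cone `σ`, and EVERY POINT `y` of either pencil chart `V(Φ_W(σ))`, `V(Φ_U(σ))` of `Bl_{𝒥𝒪}(X_Σ)` — i.e. the affine schemes `Spec k[W,y]/(Φ_W(σ))`, `Spec k[U,y]/(Φ_U(σ))` are `FullCl p` AT EVERY
STALK: domain, every system of parameters weakly regular, every parameter ideal Frobenius closed. Proof: ✓p702704 over `K = k̄` → ✓ `hypersurface_fullCl_of_rational_over_algClosed`.
* §1 generic `fullCl_pencilChartW_allPoints_of_checkExits'` / `fullCl_pencilChartU_allPoints_of_checkExits'`; §2 ★★★ `omega1_G9/G10/G10Q_pencilChartW/U_fullCl_allPoints`.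
[cite: Fedder1983, Prop. 1.7 and Thm. 1.12]
-/


set_option linter.dupNamespace false

noncomputable section

open AlgebraicGeometry IsLocalRing MvPolynomial
open scoped Pointwise

namespace Summit.ResolutionOfSingularities.ResolutionOfSingularities.Theorems.FInjectiveMacaulayfication.OmegaLocalCureRowAllPoints

open Summit.ResolutionOfSingularities.ResolutionOfSingularities.Theorems.FInjectiveMacaulayfication
open FanCheckKit FanCheckSound OmegaOneCureFanCert OmegaOneCureFanCertStrong OmegaExitBridge OmegaLocalCureRow HypersurfaceFullClAllPoints SliceableCentre

/-! ## §1 Generic: every point of both pencil charts on a certified fan -/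

section Generic

variable (k : Type) [Field k]

/-- ★★ **`W`-CHARTS FULL AT EVERY POINT ON A CERTIFIED FAN** (closed or not, any residue field; `p ≥ 5`). [OURS · TASK 4c (r2⁺); cite: Fedder1983, Thm. 1.12] -/
theorem fullCl_pencilChartW_allPoints_of_checkExits' (p : ℕ) [Fact p.Prime] [CharP k p] (hp5 : 5 ≤ p) (n e CI : ℕ) (P Q : List ℕ) (RAYS CONES ORB TAGS : List (List ℕ))
    (hchk : checkExits' n e CI P Q RAYS CONES ORB TAGS = true) (hORB : ∀ Z ∈ (List.range n).sublists, Z ≠ [] → Z ∈ ORB) (hlen : ∀ σ ∈ CONES, σ.length = n)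
    (hAB : ∀ σ ∈ CONES, ((raysOf RAYS σ).map fun ρ => dotL ρ P) ≠ ((raysOf RAYS σ).map fun ρ => dotL ρ Q)) (σ : List ℕ) (hσ : σ ∈ CONES) :
    let rows := raysOf RAYS σ
    let Cv := rows.map fun ρ => e * getL ρ CI 0
    let Av := rows.map fun ρ => dotL ρ P
    let Bv := rows.map fun ρ => dotL ρ Q
    let mv := vmin Av Bv
    let Gv := vmin Cv mv
    let M₁ := expOf n (vsub Cv Gv)
    let M₂ := expOf n (vsub mv Gv)
    let r := expOf n (vsub Av mv)
    let s := expOf n (vsub Bv mv)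
    let Φ : MvPolynomial (Fin (n + 1)) k := rename Fin.succ (monomial M₁ (1 : k)) * X 0 - rename Fin.succ (monomial M₂ (1 : k) * (monomial r 1 - monomial s 1))
    ∀ (y : Spec (.of (MvPolynomial (Fin (n + 1)) k ⧸ Ideal.span {Φ}))), FullCl p ((Spec (.of (MvPolynomial (Fin (n + 1)) k ⧸ Ideal.span {Φ}))).presheaf.stalk y) := by
  intro rows Cv Av Bv mv Gv M₁ M₂ r s Φ y
  have hn : rows.length = n := (length_raysOf RAYS σ).trans (hlen σ hσ)
  obtain ⟨hdisj, hrs, hne⟩ := exitData_props e CI P Q rows hn (hAB σ hσ) M₁ M₂ r s (fun i => expOf_apply' n _ i) (fun i => expOf_apply' n _ i)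
    (fun i => expOf_apply' n _ i) (fun i => expOf_apply' n _ i)
  have hΦp : Prime Φ := PencilPhiPrime.prime_pencilPhiW k M₁ M₂ r s hdisj hrs hne
  refine hypersurface_fullCl_of_rational_over_algClosed k (AlgebraicClosure k) p Φ hΦp
    (rename Fin.succ (monomial M₁ (1 : AlgebraicClosure k)) * X 0 - rename Fin.succ (monomial M₂ (1 : AlgebraicClosure k) * (monomial r 1 - monomial s 1))) ?_ ?_ y
  · change map (algebraMap k (AlgebraicClosure k)) (rename Fin.succ (monomial M₁ (1 : k)) * X 0 - rename Fin.succ (monomial M₂ (1 : k) * (monomial r 1 - monomial s 1))) = _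
    simp only [map_sub, map_mul, map_rename, map_monomial, map_one, map_X]
  · intro c' y' hy' ha'
    haveI : CharP (AlgebraicClosure k) p := charP_of_injective_algebraMap (algebraMap k (AlgebraicClosure k)).injective p
    rw [← Fin.cons_self_tail c', ← PencilExitTagMaster.range_cons_eq] at ha'
    exact fullCl_pencilChartW_of_checkExits' (AlgebraicClosure k) p hp5 n e CI P Q RAYS CONES ORB TAGS hchk hORB hlen hAB σ hσ (Fin.tail c') (c' 0) y' hy' ha'

/-- ★★ **`U`-CHARTS FULL AT EVERY POINT ON A CERTIFIED FAN** (closed or not, any residue field; `p ≥ 5`). [OURS · TASK 4c (r2⁺); cite: Fedder1983, Thm. 1.12] -/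
theorem fullCl_pencilChartU_allPoints_of_checkExits' (p : ℕ) [Fact p.Prime] [CharP k p] (hp5 : 5 ≤ p) (n e CI : ℕ) (P Q : List ℕ) (RAYS CONES ORB TAGS : List (List ℕ))
    (hchk : checkExits' n e CI P Q RAYS CONES ORB TAGS = true) (hORB : ∀ Z ∈ (List.range n).sublists, Z ≠ [] → Z ∈ ORB) (hlen : ∀ σ ∈ CONES, σ.length = n)
    (hAB : ∀ σ ∈ CONES, ((raysOf RAYS σ).map fun ρ => dotL ρ P) ≠ ((raysOf RAYS σ).map fun ρ => dotL ρ Q)) (σ : List ℕ) (hσ : σ ∈ CONES) :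
    let rows := raysOf RAYS σ
    let Cv := rows.map fun ρ => e * getL ρ CI 0
    let Av := rows.map fun ρ => dotL ρ P
    let Bv := rows.map fun ρ => dotL ρ Q
    let mv := vmin Av Bv
    let Gv := vmin Cv mv
    let M₁ := expOf n (vsub Cv Gv)
    let M₂ := expOf n (vsub mv Gv)
    let r := expOf n (vsub Av mv)
    let s := expOf n (vsub Bv mv)
    let Φ : MvPolynomial (Fin (n + 1)) k := rename Fin.succ (monomial M₂ (1 : k) * (monomial r 1 - monomial s 1)) * X 0 - rename Fin.succ (monomial M₁ (1 : k))
    ∀ (y : Spec (.of (MvPolynomial (Fin (n + 1)) k ⧸ Ideal.span {Φ}))), FullCl p ((Spec (.of (MvPolynomial (Fin (n + 1)) k ⧸ Ideal.span {Φ}))).presheaf.stalk y) := by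
  intro rows Cv Av Bv mv Gv M₁ M₂ r s Φ y
  have hn : rows.length = n := (length_raysOf RAYS σ).trans (hlen σ hσ)
  obtain ⟨hdisj, hrs, hne⟩ := exitData_props e CI P Q rows hn (hAB σ hσ) M₁ M₂ r s (fun i => expOf_apply' n _ i) (fun i => expOf_apply' n _ i)
    (fun i => expOf_apply' n _ i) (fun i => expOf_apply' n _ i)
  have hΦp : Prime Φ := PencilPhiPrimeU.prime_pencilPhiU k M₁ M₂ r s hdisj hrs hne
  refine hypersurface_fullCl_of_rational_over_algClosed k (AlgebraicClosure k) p Φ hΦp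
    (rename Fin.succ (monomial M₂ (1 : AlgebraicClosure k) * (monomial r 1 - monomial s 1)) * X 0 - rename Fin.succ (monomial M₁ (1 : AlgebraicClosure k))) ?_ ?_ y
  · change map (algebraMap k (AlgebraicClosure k)) (rename Fin.succ (monomial M₂ (1 : k) * (monomial r 1 - monomial s 1)) * X 0 - rename Fin.succ (monomial M₁ (1 : k))) = _
    simp only [map_sub, map_mul, map_rename, map_monomial, map_one, map_X]
  · intro c' y' hy' ha'
    haveI : CharP (AlgebraicClosure k) p := charP_of_injective_algebraMap (algebraMap k (AlgebraicClosure k)).injective p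
    rw [← Fin.cons_self_tail c', ← PencilExitTagMaster.range_cons_eq] at ha'
    exact fullCl_pencilChartU_of_checkExits' (AlgebraicClosure k) p hp5 n e CI P Q RAYS CONES ORB TAGS hchk hORB hlen hAB σ hσ (Fin.tail c') (c' 0) y' hy' ha'

end Generic

/-! ## §2 ★★★ THE ROW AT EVERY POINT on the three fans -/

section Row

variable (k : Type) [Field k] (p : ℕ) [Fact p.Prime] [CharP k p]

/-- ★★★ **Ω₁ LOCAL CURE ROW, Γ₉ (G9), `W`-CHARTS, EVERY POINT**: for every cone `σ` of the cure fan and every point `y` of the `W`-pencil chart (any residue field):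
`FullCl p 𝒪_y`, `p ≥ 5`, `k` any field of characteristic `p`. [OURS · TASK 4c (r2⁺); cite: Fedder1983, Thm. 1.12] -/
theorem omega1_G9_pencilChartW_fullCl_allPoints (hp5 : 5 ≤ p) (σ : List ℕ) (hσ : σ ∈ CONES_G9) :
    let rows := raysOf RAYS_G9 σ
    let Cv := rows.map fun ρ => 22 * getL ρ 2 0
    let Av := rows.map fun ρ => dotL ρ [2, 0, 0]
    let Bv := rows.map fun ρ => dotL ρ [0, 3, 0]
    let mv := vmin Av Bv
    let Gv := vmin Cv mv
    let M₁ := expOf 3 (vsub Cv Gv)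
    let M₂ := expOf 3 (vsub mv Gv)
    let r := expOf 3 (vsub Av mv)
    let s := expOf 3 (vsub Bv mv)
    let Φ : MvPolynomial (Fin 4) k := rename Fin.succ (monomial M₁ (1 : k)) * X 0 - rename Fin.succ (monomial M₂ (1 : k) * (monomial r 1 - monomial s 1))
    ∀ (y : Spec (.of (MvPolynomial (Fin 4) k ⧸ Ideal.span {Φ}))), FullCl p ((Spec (.of (MvPolynomial (Fin 4) k ⧸ Ideal.span {Φ}))).presheaf.stalk y) :=
  fullCl_pencilChartW_allPoints_of_checkExits' k p hp5 3 22 2 [2, 0, 0] [0, 3, 0] RAYS_G9 CONES_G9 ORB3 TAGS_G9 cert'_G9 orb3_complete sides_G9.1 sides_G9.2 σ hσ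

/-- ★★★ **Ω₁ LOCAL CURE ROW, Γ₉ (G9), `U`-CHARTS, EVERY POINT.** [OURS · TASK 4c (r2⁺); cite: Fedder1983, Thm. 1.12] -/
theorem omega1_G9_pencilChartU_fullCl_allPoints (hp5 : 5 ≤ p) (σ : List ℕ) (hσ : σ ∈ CONES_G9) :
    let rows := raysOf RAYS_G9 σ
    let Cv := rows.map fun ρ => 22 * getL ρ 2 0
    let Av := rows.map fun ρ => dotL ρ [2, 0, 0]
    let Bv := rows.map fun ρ => dotL ρ [0, 3, 0]
    let mv := vmin Av Bv
    let Gv := vmin Cv mv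
    let M₁ := expOf 3 (vsub Cv Gv)
    let M₂ := expOf 3 (vsub mv Gv)
    let r := expOf 3 (vsub Av mv)
    let s := expOf 3 (vsub Bv mv)
    let Φ : MvPolynomial (Fin 4) k := rename Fin.succ (monomial M₂ (1 : k) * (monomial r 1 - monomial s 1)) * X 0 - rename Fin.succ (monomial M₁ (1 : k))
    ∀ (y : Spec (.of (MvPolynomial (Fin 4) k ⧸ Ideal.span {Φ}))), FullCl p ((Spec (.of (MvPolynomial (Fin 4) k ⧸ Ideal.span {Φ}))).presheaf.stalk y) :=
  fullCl_pencilChartU_allPoints_of_checkExits' k p hp5 3 22 2 [2, 0, 0] [0, 3, 0] RAYS_G9 CONES_G9 ORB3 TAGS_G9 cert'_G9 orb3_complete sides_G9.1 sides_G9.2 σ hσ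

/-- ★★★ **Ω₁ LOCAL CURE ROW, Γ₁₀ generic point (G10), `W`-CHARTS, EVERY POINT.** [OURS · TASK 4c (r2⁺); cite: Fedder1983, Thm. 1.12] -/
theorem omega1_G10_pencilChartW_fullCl_allPoints (hp5 : 5 ≤ p) (σ : List ℕ) (hσ : σ ∈ CONES_G10) :
    let rows := raysOf RAYS_G10 σ
    let Cv := rows.map fun ρ => 43 * getL ρ 2 0
    let Av := rows.map fun ρ => dotL ρ [2, 0, 0]
    let Bv := rows.map fun ρ => dotL ρ [0, 3, 0]
    let mv := vmin Av Bv
    let Gv := vmin Cv mv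
    let M₁ := expOf 3 (vsub Cv Gv)
    let M₂ := expOf 3 (vsub mv Gv)
    let r := expOf 3 (vsub Av mv)
    let s := expOf 3 (vsub Bv mv)
    let Φ : MvPolynomial (Fin 4) k := rename Fin.succ (monomial M₁ (1 : k)) * X 0 - rename Fin.succ (monomial M₂ (1 : k) * (monomial r 1 - monomial s 1))
    ∀ (y : Spec (.of (MvPolynomial (Fin 4) k ⧸ Ideal.span {Φ}))), FullCl p ((Spec (.of (MvPolynomial (Fin 4) k ⧸ Ideal.span {Φ}))).presheaf.stalk y) :=
  fullCl_pencilChartW_allPoints_of_checkExits' k p hp5 3 43 2 [2, 0, 0] [0, 3, 0] RAYS_G10 CONES_G10 ORB3 TAGS_G10 cert'_G10 orb3_complete sides_G10.1 sides_G10.2 σ hσ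

/-- ★★★ **Ω₁ LOCAL CURE ROW, Γ₁₀ generic point (G10), `U`-CHARTS, EVERY POINT.** [OURS · TASK 4c (r2⁺); cite: Fedder1983, Thm. 1.12] -/
theorem omega1_G10_pencilChartU_fullCl_allPoints (hp5 : 5 ≤ p) (σ : List ℕ) (hσ : σ ∈ CONES_G10) :
    let rows := raysOf RAYS_G10 σ
    let Cv := rows.map fun ρ => 43 * getL ρ 2 0
    let Av := rows.map fun ρ => dotL ρ [2, 0, 0]
    let Bv := rows.map fun ρ => dotL ρ [0, 3, 0]
    let mv := vmin Av Bv
    let Gv := vmin Cv mv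
    let M₁ := expOf 3 (vsub Cv Gv)
    let M₂ := expOf 3 (vsub mv Gv)
    let r := expOf 3 (vsub Av mv)
    let s := expOf 3 (vsub Bv mv)
    let Φ : MvPolynomial (Fin 4) k := rename Fin.succ (monomial M₂ (1 : k) * (monomial r 1 - monomial s 1)) * X 0 - rename Fin.succ (monomial M₁ (1 : k))
    ∀ (y : Spec (.of (MvPolynomial (Fin 4) k ⧸ Ideal.span {Φ}))), FullCl p ((Spec (.of (MvPolynomial (Fin 4) k ⧸ Ideal.span {Φ}))).presheaf.stalk y) :=
  fullCl_pencilChartU_allPoints_of_checkExits' k p hp5 3 43 2 [2, 0, 0] [0, 3, 0] RAYS_G10 CONES_G10 ORB3 TAGS_G10 cert'_G10 orb3_complete sides_G10.1 sides_G10.2 σ hσ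

/-- ★★★ **Ω₁ LOCAL CURE ROW, Γ₁₀ at `Q*` (G10Q), `W`-CHARTS, EVERY POINT.** [OURS · TASK 4c (r2⁺); cite: Fedder1983, Thm. 1.12] -/
theorem omega1_G10Q_pencilChartW_fullCl_allPoints (hp5 : 5 ≤ p) (σ : List ℕ) (hσ : σ ∈ CONES_G10Q) :
    let rows := raysOf RAYS_G10Q σ
    let Cv := rows.map fun ρ => 43 * getL ρ 3 0
    let Av := rows.map fun ρ => dotL ρ [1, 2, 0, 0]
    let Bv := rows.map fun ρ => dotL ρ [0, 0, 3, 0]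
    let mv := vmin Av Bv
    let Gv := vmin Cv mv
    let M₁ := expOf 4 (vsub Cv Gv)
    let M₂ := expOf 4 (vsub mv Gv)
    let r := expOf 4 (vsub Av mv)
    let s := expOf 4 (vsub Bv mv)
    let Φ : MvPolynomial (Fin 5) k := rename Fin.succ (monomial M₁ (1 : k)) * X 0 - rename Fin.succ (monomial M₂ (1 : k) * (monomial r 1 - monomial s 1))
    ∀ (y : Spec (.of (MvPolynomial (Fin 5) k ⧸ Ideal.span {Φ}))), FullCl p ((Spec (.of (MvPolynomial (Fin 5) k ⧸ Ideal.span {Φ}))).presheaf.stalk y) :=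
  fullCl_pencilChartW_allPoints_of_checkExits' k p hp5 4 43 3 [1, 2, 0, 0] [0, 0, 3, 0] RAYS_G10Q CONES_G10Q ORB4 TAGS_G10Q cert'_G10Q orb4_complete sides_G10Q.1 sides_G10Q.2 σ hσ

/-- ★★★ **Ω₁ LOCAL CURE ROW, Γ₁₀ at `Q*` (G10Q), `U`-CHARTS, EVERY POINT.** [OURS · TASK 4c (r2⁺); cite: Fedder1983, Thm. 1.12] -/
theorem omega1_G10Q_pencilChartU_fullCl_allPoints (hp5 : 5 ≤ p) (σ : List ℕ) (hσ : σ ∈ CONES_G10Q) :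
    let rows := raysOf RAYS_G10Q σ
    let Cv := rows.map fun ρ => 43 * getL ρ 3 0
    let Av := rows.map fun ρ => dotL ρ [1, 2, 0, 0]
    let Bv := rows.map fun ρ => dotL ρ [0, 0, 3, 0]
    let mv := vmin Av Bv
    let Gv := vmin Cv mv
    let M₁ := expOf 4 (vsub Cv Gv)
    let M₂ := expOf 4 (vsub mv Gv)
    let r := expOf 4 (vsub Av mv)
    let s := expOf 4 (vsub Bv mv)
    let Φ : MvPolynomial (Fin 5) k := rename Fin.succ (monomial M₂ (1 : k) * (monomial r 1 - monomial s 1)) * X 0 - rename Fin.succ (monomial M₁ (1 : k))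
    ∀ (y : Spec (.of (MvPolynomial (Fin 5) k ⧸ Ideal.span {Φ}))), FullCl p ((Spec (.of (MvPolynomial (Fin 5) k ⧸ Ideal.span {Φ}))).presheaf.stalk y) :=
  fullCl_pencilChartU_allPoints_of_checkExits' k p hp5 4 43 3 [1, 2, 0, 0] [0, 0, 3, 0] RAYS_G10Q CONES_G10Q ORB4 TAGS_G10Q cert'_G10Q orb4_complete sides_G10Q.1 sides_G10Q.2 σ hσ

end Row

end Summit.ResolutionOfSingularities.ResolutionOfSingularities.Theorems.FInjectiveMacaulayfication.OmegaLocalCureRowAllPoints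

end
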